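import Summits.Ventures.HSemireg.WedgeHankelSiegelIdeal

/-!
# Venture HSemireg — THE SIEGEL IDEAL (2/3): the STANDARD MONOMIALS `x_{S∖A} ∧ y_A` — independent under the symmetrisation, and every
# monomial of `⋀^k K^{2n}` is one of them modulo the Siegel ideal

HONEST FRAMING. Part of the Lean index of the computation cell `pub-hsemireg` (seat p10 gen 11, Sunday typer «UNIFORM-IN-n»).
Finite-dimensional EXTERIOR ALGEBRA over a field ONLY (plus polynomials in one central variable); no variety, no cohomology theory, no
sheaf, no Ext group, no semiregularity map; nothing here says that HC / HC_CM / HC_AV holds; no Literature fact is declared or used.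
Custodian versions as in `WedgeHankelSiegelIdeal` (1/3); the dictionary is QUOTED there, never asserted.

THIS FILE (continues namespace `Summit.Ventures.HSemireg.Wedge.HankelSiegelIdeal`; imports (1/3) only):
* §3 (continued) **THE STANDARD MONOMIALS** `r_{S,i} := x_{S ∖ A} ∧ y_A` (`rep`), one for each `k`-set `S` of pairs and each `y`-count
  `i ≤ k` (`A = canon S i`, ANY fixed `i`-subset of `S` — only `A ⊆ S`, `|A| = i` are used), `(k+1)·C(n,k)` of them (`card_RIdx`); they lie in
  `⋀^k`; **`sym (r_{S,i}) = c·u_S·t^i`, `c ≠ 0`** (`sym_rep`); the targets `u_S·t^i` are linearly independent (`linearIndependent_tmon`, a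
  coefficient of a basis monomial), hence **`linearIndependent_sym_rep`** and **`card_le_finrank_range_symk`: `rank(sym ∣ ⋀^k) ≥ (k+1)·C(n,k)`**.
* §4 **THE REDUCTION**: `B_mem_siegelIdeal_of_pair` — a monomial containing a full pair `x_a, y_a` lies in `SI_k` (it is `c·E_{t₀} ∧ x_a y_a`);
  `B_swap_mem` — THE SWAP `E_{t ∪ {x_a,y_b}} ≡ −c·E_{t ∪ {x_b,y_a}} (mod SI_k)` (their combination is `E_t ∧ s_{ab}`); by induction on the
  number of `y`-letters outside the canonical positions (`B_xs_ys_mem_aux`), **`B_mem_repSpan_sup`: EVERY monomial `E_t` lies in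
  `span{r_{S,i}} + SI_{|t|}`**, i.e. **`exteriorPower_le_repSpan_sup`: `⋀^k ≤ span{r_{S,i}} ⊔ SI_k`**.
With (1/3) (`SI_k ≤ ker sym`) this sandwiches `dim SI_k`; the numbers are drawn in (3/3).  Sign-free throughout (structure constants are
units, never evaluated; `Hankel.u`).  NOT typed: an explicit normal form / sign for the reduction; anything Ext-side.  Class side only.
-/

open Module

namespace Summit.Ventures.HSemireg.Wedge.HankelSiegelIdeal

open Summit.Ventures.HSemireg.Wedge Summit.Ventures.HSemireg.Wedge.Hankel
  Summit.Ventures.HSemireg.Wedge.HankelSiegel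

variable (K : Type*) [Field K] {n : ℕ}

/-! ## §3 (continued). The standard monomials `x_{S∖A} ∧ y_A`: independent images under `sym` -/

/-- a fixed `i`-element subset of `S` (for `i ≤ |S|`; any choice — only `⊆ S` and the cardinality are used). -/
noncomputable def canon (S : Finset (Fin n)) (i : ℕ) : Finset (Fin n) :=
  if h : i ≤ S.card then (Finset.exists_subset_card_eq h).choose else ∅

/-- `canon S i ⊆ S`. -/
lemma canon_subset (S : Finset (Fin n)) (i : ℕ) : canon S i ⊆ S := by
  unfold canon
  split_ifs with h
  · exact (Finset.exists_subset_card_eq h).choose_spec.1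
  · exact Finset.empty_subset _

/-- `|canon S i| = i` for `i ≤ |S|`. -/
lemma card_canon {S : Finset (Fin n)} {i : ℕ} (h : i ≤ S.card) : (canon S i).card = i := by
  rw [canon, dif_pos h]
  exact (Finset.exists_subset_card_eq h).choose_spec.2

/-- index of the standard monomials of degree `k`: a `k`-set `S` of pairs and a `y`-count `i ≤ k`. -/
abbrev RIdx (n k : ℕ) : Type := {S : Finset (Fin n) // S.card = k} × Fin (k + 1)

/-- **THE STANDARD MONOMIALS** `r_{S,i} := x_{S ∖ A} ∧ y_A`, `A = canon S i` (one monomial per `k`-set `S` and `y`-count `i`). -/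
noncomputable def rep {k : ℕ} (p : RIdx n k) : HT K (In n) :=
  B K (In n) (xs (p.1.1 \ canon p.1.1 p.2)) * B K (In n) (ys (canon p.1.1 p.2))

/-- the target monomials `u_S · t^i`. -/
noncomputable def tmon {k : ℕ} (p : RIdx n k) : SymA K n := Polynomial.monomial (p.2 : ℕ) (B K (Fin n) p.1.1)

/-- the standard monomial is a non-zero multiple of a basis monomial of degree `k`. -/
lemma rep_eq_smul_B {k : ℕ} (p : RIdx n k) :
    ∃ c : K, c ≠ 0 ∧ rep K p = c • B K (In n) (xs (p.1.1 \ canon p.1.1 p.2) ∪ ys (canon p.1.1 p.2)) :=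
  ⟨_, (u_ne_zero_iff K).mpr (disjoint_xs_ys _ _), by rw [rep, B_mul_B]⟩

/-- the support of the standard monomial has cardinality `k`. -/
lemma card_supp_rep {k : ℕ} (p : RIdx n k) :
    (xs (p.1.1 \ canon p.1.1 p.2) ∪ ys (canon p.1.1 p.2)).card = k := by
  have hi : (p.2 : ℕ) ≤ p.1.1.card := by rw [p.1.2]; have := p.2.2; omega
  rw [Finset.card_union_of_disjoint (disjoint_xs_ys _ _), card_xs, card_ys,
    Finset.card_sdiff_of_subset (canon_subset _ _), card_canon hi, p.1.2]
  have := p.2.2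
  omega

/-- the standard monomials lie in `⋀^k`. -/
lemma rep_mem_exteriorPower {k : ℕ} (p : RIdx n k) : rep K p ∈ ⋀[K]^k (In n → K) := by
  obtain ⟨c, -, hc⟩ := rep_eq_smul_B K p
  rw [hc, exteriorPower_eq_Hom_univ]
  exact Submodule.smul_mem _ _ (B_mem_Hom K (Finset.subset_univ _) (card_supp_rep p))

/-- **`sym (r_{S,i}) = c · u_S · t^i` with `c ≠ 0`.** -/
lemma sym_rep {k : ℕ} (p : RIdx n k) : ∃ c : K, c ≠ 0 ∧ sym K (rep K p) = c • tmon K p := by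
  obtain ⟨⟨S, hS⟩, i⟩ := p
  have hi : (i : ℕ) ≤ S.card := by rw [hS]; have := i.2; omega
  obtain ⟨c₁, hc₁, h₁⟩ := sym_B_xs K (S \ canon S i)
  obtain ⟨c₂, hc₂, h₂⟩ := sym_B_ys K (canon S i)
  have h₃ : B K (Fin n) (S \ canon S i) * B K (Fin n) (canon S i) = u K (S \ canon S i) (canon S i) • B K (Fin n) S := by
    rw [B_mul_B, Finset.sdiff_union_of_subset (canon_subset S i)]
  refine ⟨c₁ * c₂ * u K (S \ canon S i) (canon S i),
    by simp [hc₁, hc₂, (u_ne_zero_iff K).mpr Finset.sdiff_disjoint], ?_⟩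
  simp only [rep]
  rw [map_mul, h₁, h₂, smul_mul_smul_comm, Polynomial.monomial_mul_monomial, zero_add, card_canon hi, h₃,
    ← Polynomial.smul_monomial, smul_smul, tmon]

/-- **the target monomials `u_S · t^i` are linearly independent** (distinct coefficients of distinct basis monomials). -/
theorem linearIndependent_tmon (k : ℕ) : LinearIndependent K (tmon K (n := n) (k := k)) := by
  rw [linearIndependent_iff']
  intro s g hsum p hp
  obtain ⟨⟨S, hS⟩, i⟩ := p
  have h := congrArg (fun f : SymA K n => (B K (Fin n)).coord S (f.coeff (i : ℕ))) hsum
  simp only [Polynomial.finsetSum_coeff, Polynomial.coeff_smul, map_sum, map_smul, Polynomial.coeff_zero,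
    map_zero] at h
  rw [Finset.sum_eq_single (⟨⟨S, hS⟩, i⟩ : RIdx n k)] at h
  · rw [tmon, Polynomial.coeff_monomial, if_pos rfl, Basis.coord_apply, Basis.repr_self, Finsupp.single_eq_same,
      smul_eq_mul, mul_one] at h
    exact h
  · rintro ⟨⟨S', hS'⟩, i'⟩ _ hne
    rw [tmon, Polynomial.coeff_monomial]
    split_ifs with hii
    · rw [Basis.coord_apply, Basis.repr_self, Finsupp.single_apply, if_neg, smul_zero]
      intro hSS
      apply hne
      simp only at hii hSS
      subst hSS
      have : i' = i := Fin.ext hii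
      subst this
      rfl
    · rw [map_zero, smul_zero]
  · intro hp'
    exact absurd hp hp'

/-- **the images `sym (r_{S,i})` are linearly independent.** -/
theorem linearIndependent_sym_rep (k : ℕ) : LinearIndependent K (fun p : RIdx n k => sym K (rep K p)) := by
  choose c hc h using fun p : RIdx n k => sym_rep K p
  have : (fun p : RIdx n k => sym K (rep K p)) = (fun p => Units.mk0 (c p) (hc p)) • tmon K (n := n) (k := k) := by
    funext p
    rw [h p, Pi.smul_apply', Units.smul_mk0]
  rw [this]
  exact (linearIndependent_tmon K k).units_smul _

/-- the number of standard monomials of degree `k` is `(k+1) · C(n,k)`. -/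
lemma card_RIdx (k : ℕ) : Fintype.card (RIdx n k) = (k + 1) * n.choose k := by
  rw [Fintype.card_prod, Fintype.card_finset_len, Fintype.card_fin, Fintype.card_fin, mul_comm]

/-- `sym` restricted to `⋀^k`. -/
noncomputable def symk (n k : ℕ) : (⋀[K]^k (In n → K)) →ₗ[K] SymA K n :=
  (sym K).toLinearMap ∘ₗ (⋀[K]^k (In n → K)).subtype

/-- **RANK OF THE SYMMETRISATION ON `⋀^k` IS AT LEAST `(k+1)·C(n,k)`** (the standard monomials have independent images). -/
theorem card_le_finrank_range_symk (k : ℕ) : (k + 1) * n.choose k ≤ finrank K (LinearMap.range (symk K n k)) := by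
  let f : RIdx n k → LinearMap.range (symk K n k) := fun p =>
    ⟨sym K (rep K p), ⟨⟨rep K p, rep_mem_exteriorPower K p⟩, rfl⟩⟩
  have hf : LinearIndependent K f := by
    apply LinearIndependent.of_comp (LinearMap.range (symk K n k)).subtype
    exact linearIndependent_sym_rep K k
  rw [← card_RIdx]
  exact hf.fintype_card_le_finrank

/-! ## §4. Reduction: every monomial of degree `k` is a standard monomial modulo the Siegel ideal -/

/-- `X_a` is the generator monomial `E_{x_a}`. -/
lemma X_eq_gx (a : Fin n) : X K n a = gx K (Fin.castAdd n a) := by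
  rw [X, dif_pos a.2]; rfl

/-- `Y_a` is the generator monomial `E_{y_a}`. -/
lemma Y_eq_gx (a : Fin n) : Y K n a = gx K (Fin.natAdd n a) := by
  rw [Y, dif_pos a.2]; rfl

/-- a monomial times a fresh generator on the right: `E_t ∧ E_{i} = c • E_{insert i t}` with `c ≠ 0`. -/
lemma B_mul_gx {I : Type*} [LinearOrder I] [Fintype I] {i : I} {t : Finset I} (hi : i ∉ t) :
    ∃ c : K, c ≠ 0 ∧ B K I t * gx K i = c • B K I (insert i t) :=
  ⟨u K t {i}, (u_ne_zero_iff K).mpr (Finset.disjoint_singleton_right.mpr hi),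
    by rw [gx, B_mul_B, Finset.union_comm, ← Finset.insert_eq]⟩

/-- `E_t ∧ x_a ∧ y_b = c • E_{t ∪ {x_a, y_b}}` (`c ≠ 0`) for fresh `x_a`, `y_b`. -/
lemma B_mul_X_mul_Y {t : Finset (In n)} {a c : Fin n} (ha : Fin.castAdd n a ∉ t) (hc : Fin.natAdd n c ∉ t) :
    ∃ e : K, e ≠ 0 ∧ B K (In n) t * (X K n a * Y K n c) = e • B K (In n) (insert (Fin.castAdd n a) (insert (Fin.natAdd n c) t)) := by
  obtain ⟨e₁, he₁, h₁⟩ := B_mul_gx K (I := In n) ha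
  obtain ⟨e₂, he₂, h₂⟩ := B_mul_gx K (I := In n) (i := Fin.natAdd n c) (t := insert (Fin.castAdd n a) t)
    (by rw [Finset.mem_insert, not_or]; exact ⟨(castAdd_ne_natAdd a c).symm, hc⟩)
  refine ⟨e₁ * e₂, mul_ne_zero he₁ he₂, ?_⟩
  rw [X_eq_gx, Y_eq_gx, ← mul_assoc, h₁, smul_mul_assoc, h₂, smul_smul, Finset.insert_comm]

/-- `E_t ∧ s_{ab}` lies in the Siegel ideal of degree `|t| + 2` (either order of `a`, `b`). -/
lemma B_mul_sv_mem {t : Finset (In n)} {k : ℕ} (hk : t.card + 2 = k) (a c : Fin n) :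
    B K (In n) t * sv K (n := n) a c ∈ siegelIdeal K n k := by
  rcases le_or_gt a c with hac | hca
  · exact Submodule.subset_span ⟨(⟨t, hk⟩, ⟨c, ⟨a, by simpa using Nat.lt_succ_of_le hac⟩⟩), rfl⟩
  · have hsv : sv K (n := n) (a : ℕ) c = sv K (c : ℕ) a := by
      unfold sv
      rw [if_neg (by simpa [Fin.ext_iff] using hca.ne'), if_neg (by simpa [Fin.ext_iff] using hca.ne), add_comm]
    rw [hsv]
    exact Submodule.subset_span ⟨(⟨t, hk⟩, ⟨a, ⟨c, by simpa using hca.le⟩⟩), rfl⟩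

/-- **a monomial containing a full pair `x_a, y_a` lies in the Siegel ideal** (it is `± E_{t₀} ∧ x_a y_a`). -/
theorem B_mem_siegelIdeal_of_pair {t : Finset (In n)} {a : Fin n} (hx : Fin.castAdd n a ∈ t) (hy : Fin.natAdd n a ∈ t) :
    B K (In n) t ∈ siegelIdeal K n t.card := by
  set t₀ := (t.erase (Fin.castAdd n a)).erase (Fin.natAdd n a) with ht₀
  have hya : Fin.natAdd n a ∈ t.erase (Fin.castAdd n a) := Finset.mem_erase.mpr ⟨(castAdd_ne_natAdd a a).symm, hy⟩
  have ht : insert (Fin.castAdd n a) (insert (Fin.natAdd n a) t₀) = t := by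
    rw [ht₀, Finset.insert_erase hya, Finset.insert_erase hx]
  have hx₀ : Fin.castAdd n a ∉ t₀ := fun h => Finset.notMem_erase _ _ (Finset.mem_of_mem_erase h)
  have hy₀ : Fin.natAdd n a ∉ t₀ := Finset.notMem_erase _ _
  have hcard : t₀.card + 2 = t.card := by
    rw [← ht, Finset.card_insert_of_notMem (by rw [Finset.mem_insert, not_or]; exact ⟨castAdd_ne_natAdd a a, hx₀⟩),
      Finset.card_insert_of_notMem hy₀]
  obtain ⟨e, he, h⟩ := B_mul_X_mul_Y K hx₀ hy₀
  have hmem := B_mul_sv_mem K hcard a a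
  rw [sv, if_pos rfl, add_zero, h, ht] at hmem
  rw [← inv_smul_smul₀ he (B K (In n) t)]
  exact Submodule.smul_mem _ _ hmem

/-- **THE SWAP: `E_{t ∪ {x_a, y_b}} ≡ −c · E_{t ∪ {x_b, y_a}}` modulo the Siegel ideal** (their signed sum is `E_t ∧ s_{ab}`). -/
theorem B_swap_mem {t : Finset (In n)} {k : ℕ} (hk : t.card + 2 = k) {a c : Fin n} (hac : a ≠ c)
    (hxa : Fin.castAdd n a ∉ t) (hya : Fin.natAdd n a ∉ t) (hxc : Fin.castAdd n c ∉ t) (hyc : Fin.natAdd n c ∉ t) :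
    B K (In n) (insert (Fin.castAdd n a) (insert (Fin.natAdd n c) t)) ∈
      (K ∙ B K (In n) (insert (Fin.castAdd n c) (insert (Fin.natAdd n a) t))) ⊔ siegelIdeal K n k := by
  obtain ⟨e₁, he₁, h₁⟩ := B_mul_X_mul_Y K hxa hyc
  obtain ⟨e₂, -, h₂⟩ := B_mul_X_mul_Y K hxc hya
  have hmem := B_mul_sv_mem K hk a c
  rw [sv, if_neg (by simpa [Fin.ext_iff] using hac), mul_add, h₁, h₂] at hmem
  rw [Submodule.mem_sup]
  refine ⟨(-(e₁⁻¹ * e₂)) • B K (In n) (insert (Fin.castAdd n c) (insert (Fin.natAdd n a) t)),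
    Submodule.mem_span_singleton.mpr ⟨_, rfl⟩, e₁⁻¹ • _, Submodule.smul_mem _ _ hmem, ?_⟩
  rw [smul_add, smul_smul, smul_smul, inv_mul_cancel₀ he₁, one_smul, neg_smul]
  abel

/-- the span of the standard monomials of degree `k`. -/
noncomputable def repSpan (n k : ℕ) : Submodule K (HT K (In n)) := Submodule.span K (Set.range (rep K (n := n) (k := k)))

/-- the reduction, by induction on the number of `y`-letters outside the canonical positions. -/
lemma B_xs_ys_mem_aux {k : ℕ} (d : ℕ) : ∀ (P Q : Finset (Fin n)), Disjoint P Q → (P ∪ Q).card = k →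
    (Q \ canon (P ∪ Q) Q.card).card = d → B K (In n) (xs P ∪ ys Q) ∈ repSpan K n k ⊔ siegelIdeal K n k := by
  induction d with
  | zero =>
    intro P Q hPQ hk hd
    have hQk : Q.card < k + 1 := by rw [← hk]; exact Nat.lt_succ_of_le (Finset.card_le_card Finset.subset_union_right)
    have hA : canon (P ∪ Q) Q.card = Q :=
      (Finset.eq_of_subset_of_card_le (Finset.sdiff_eq_empty_iff_subset.mp (Finset.card_eq_zero.mp hd))
        (by rw [card_canon (by omega)])).symm
    have hP : (P ∪ Q) \ Q = P := Finset.union_sdiff_cancel_right hPQ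
    let p : RIdx n k := (⟨P ∪ Q, hk⟩, ⟨Q.card, hQk⟩)
    obtain ⟨c, hc, h⟩ := rep_eq_smul_B K p
    simp only [p] at h
    rw [hA, hP] at h
    rw [← inv_smul_smul₀ hc (B K (In n) (xs P ∪ ys Q)), ← h]
    exact Submodule.mem_sup_left (Submodule.smul_mem _ _ (Submodule.subset_span ⟨p, rfl⟩))
  | succ d ih =>
    intro P Q hPQ hk hd
    set A := canon (P ∪ Q) Q.card with hAdef
    have hAcard : A.card = Q.card := card_canon (Finset.card_le_card Finset.subset_union_right)
    obtain ⟨b, hb⟩ := Finset.card_pos.mp (by omega : 0 < (Q \ A).card)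
    have hAQ : (A \ Q).card = d + 1 := by
      have h1 := Finset.card_sdiff_add_card_inter A Q
      have h2 := Finset.card_sdiff_add_card_inter Q A
      rw [Finset.inter_comm] at h2
      omega
    obtain ⟨a, ha⟩ := Finset.card_pos.mp (by omega : 0 < (A \ Q).card)
    rw [Finset.mem_sdiff] at ha hb
    have haP : a ∈ P := (Finset.mem_union.mp (canon_subset _ _ ha.1)).resolve_right ha.2
    have hbP : b ∉ P := fun h => Finset.disjoint_left.mp hPQ h hb.1
    have hab : a ≠ b := fun h => ha.2 (h ▸ hb.1)
    -- the new pair of index sets after the swap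
    set P' := insert b (P.erase a) with hP'
    set Q' := insert a (Q.erase b) with hQ'
    set t₀ := xs (P.erase a) ∪ ys (Q.erase b) with ht₀
    have e1 : xs P ∪ ys Q = insert (Fin.castAdd n a) (insert (Fin.natAdd n b) t₀) := by
      rw [ht₀, ← Finset.union_insert, ← Finset.insert_union, ← xs_insert, ← ys_insert, Finset.insert_erase haP,
        Finset.insert_erase hb.1]
    have e2 : xs P' ∪ ys Q' = insert (Fin.castAdd n b) (insert (Fin.natAdd n a) t₀) := by
      rw [ht₀, ← Finset.union_insert, ← Finset.insert_union, ← xs_insert, ← ys_insert]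
    have nxa : Fin.castAdd n a ∉ t₀ := by
      rw [ht₀, Finset.mem_union, not_or, castAdd_mem_xs]; exact ⟨Finset.notMem_erase a P, castAdd_notMem_ys _ _⟩
    have nya : Fin.natAdd n a ∉ t₀ := by
      rw [ht₀, Finset.mem_union, not_or, natAdd_mem_ys, Finset.mem_erase, not_and']
      exact ⟨natAdd_notMem_xs _ _, fun h => absurd h ha.2⟩
    have nxb : Fin.castAdd n b ∉ t₀ := by
      rw [ht₀, Finset.mem_union, not_or, castAdd_mem_xs, Finset.mem_erase, not_and']
      exact ⟨fun h => absurd h hbP, castAdd_notMem_ys _ _⟩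
    have nyb : Fin.natAdd n b ∉ t₀ := by
      rw [ht₀, Finset.mem_union, not_or, natAdd_mem_ys]; exact ⟨natAdd_notMem_xs _ _, Finset.notMem_erase b Q⟩
    have hPc := Finset.card_erase_of_mem haP
    have hQc := Finset.card_erase_of_mem hb.1
    have hPpos : 0 < P.card := Finset.card_pos.mpr ⟨a, haP⟩
    have hQpos : 0 < Q.card := Finset.card_pos.mpr ⟨b, hb.1⟩
    have hkPQ : P.card + Q.card = k := by rw [← Finset.card_union_of_disjoint hPQ, hk]
    have ht₀k : t₀.card + 2 = k := by
      rw [ht₀, Finset.card_union_of_disjoint (disjoint_xs_ys _ _), card_xs, card_ys, hPc, hQc]; omega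
    -- bookkeeping for the swapped pair
    have hPQ' : Disjoint P' Q' := by
      rw [Finset.disjoint_left]
      intro x hx hx'
      rw [hP', Finset.mem_insert, Finset.mem_erase] at hx
      rw [hQ', Finset.mem_insert, Finset.mem_erase] at hx'
      rcases hx with rfl | ⟨hxa, hxP⟩
      · rcases hx' with h | ⟨h, -⟩
        · exact hab h.symm
        · exact h rfl
      · rcases hx' with rfl | ⟨-, hxQ⟩
        · exact hxa rfl
        · exact Finset.disjoint_left.mp hPQ hxP hxQ
    have hunion : P' ∪ Q' = P ∪ Q := by
      ext x
      simp only [hP', hQ', Finset.mem_union, Finset.mem_insert, Finset.mem_erase]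
      constructor
      · rintro ((rfl | ⟨-, h⟩) | (rfl | ⟨-, h⟩))
        · exact Or.inr hb.1
        · exact Or.inl h
        · exact Or.inl haP
        · exact Or.inr h
      · rintro (h | h)
        · by_cases hxa : x = a
          · exact Or.inr (Or.inl hxa)
          · exact Or.inl (Or.inr ⟨hxa, h⟩)
        · by_cases hxb : x = b
          · exact Or.inl (Or.inl hxb)
          · exact Or.inr (Or.inr ⟨hxb, h⟩)
    have hQ'card : Q'.card = Q.card := by
      rw [hQ', Finset.card_insert_of_notMem (fun h => ha.2 (Finset.mem_of_mem_erase h)), hQc]; omega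
    have hd' : (Q' \ canon (P' ∪ Q') Q'.card).card = d := by
      rw [hunion, hQ'card, ← hAdef]
      have : Q' \ A = (Q \ A).erase b := by
        ext x
        simp only [hQ', Finset.mem_sdiff, Finset.mem_insert, Finset.mem_erase]
        constructor
        · rintro ⟨rfl | ⟨hxb, hxQ⟩, hxA⟩
          · exact absurd ha.1 hxA
          · exact ⟨hxb, hxQ, hxA⟩
        · rintro ⟨hxb, hxQ, hxA⟩
          exact ⟨Or.inr ⟨hxb, hxQ⟩, hxA⟩
      rw [this, Finset.card_erase_of_mem (Finset.mem_sdiff.mpr hb), hd]; rfl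
    have hih := ih P' Q' hPQ' (by rw [hunion, hk]) hd'
    rw [e2] at hih
    rw [e1]
    have hle : (K ∙ B K (In n) (insert (Fin.castAdd n b) (insert (Fin.natAdd n a) t₀))) ⊔ siegelIdeal K n k ≤
        repSpan K n k ⊔ siegelIdeal K n k :=
      sup_le ((Submodule.span_singleton_le_iff_mem _ _).mpr hih) le_sup_right
    exact hle (B_swap_mem K ht₀k hab nxa nya nxb nyb)

/-- the pairs whose `x`-letter occurs in `t`. -/
def Pof (t : Finset (In n)) : Finset (Fin n) := Finset.univ.filter fun a => Fin.castAdd n a ∈ t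

/-- the pairs whose `y`-letter occurs in `t`. -/
def Qof (t : Finset (In n)) : Finset (Fin n) := Finset.univ.filter fun a => Fin.natAdd n a ∈ t

/-- every monomial support splits into its `x`-part and its `y`-part. -/
lemma xs_union_ys (t : Finset (In n)) : xs (Pof t) ∪ ys (Qof t) = t := by
  ext i
  rw [Finset.mem_union]
  constructor
  · rintro (h | h)
    · obtain ⟨a, ha, rfl⟩ := Finset.mem_map.mp h
      exact (Finset.mem_filter.mp ha).2
    · obtain ⟨a, ha, rfl⟩ := Finset.mem_map.mp h
      exact (Finset.mem_filter.mp ha).2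
  · intro hi
    cases i using Fin.addCases with
    | left a => exact Or.inl (castAdd_mem_xs.mpr (Finset.mem_filter.mpr ⟨Finset.mem_univ _, hi⟩))
    | right a => exact Or.inr (natAdd_mem_ys.mpr (Finset.mem_filter.mpr ⟨Finset.mem_univ _, hi⟩))

/-- **EVERY MONOMIAL IS A STANDARD MONOMIAL MODULO THE SIEGEL IDEAL**: `E_t ∈ span{r_{S,i}} ⊔ SI_{|t|}`. -/
theorem B_mem_repSpan_sup (t : Finset (In n)) : B K (In n) t ∈ repSpan K n t.card ⊔ siegelIdeal K n t.card := by
  by_cases h : Disjoint (Pof t) (Qof t)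
  · have ht := xs_union_ys t
    have hk : (Pof t ∪ Qof t).card = t.card := by
      conv_rhs => rw [← ht]
      rw [Finset.card_union_of_disjoint (disjoint_xs_ys _ _), card_xs, card_ys, Finset.card_union_of_disjoint h]
    have := B_xs_ys_mem_aux K _ (Pof t) (Qof t) h hk rfl
    rwa [ht] at this
  · obtain ⟨a, ha, ha'⟩ := Finset.not_disjoint_iff.mp h
    exact Submodule.mem_sup_right
      (B_mem_siegelIdeal_of_pair K (Finset.mem_filter.mp ha).2 (Finset.mem_filter.mp ha').2)

/-- **`⋀^k = span{standard monomials} + SI_k`.** -/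
theorem exteriorPower_le_repSpan_sup (k : ℕ) :
    (⋀[K]^k (In n → K) : Submodule K (HT K (In n))) ≤ repSpan K n k ⊔ siegelIdeal K n k := by
  rw [exteriorPower_eq_Hom_univ, Hom, Submodule.span_le]
  rintro _ ⟨t, ⟨-, ht⟩, rfl⟩
  rw [← ht]
  exact B_mem_repSpan_sup K t

end Summit.Ventures.HSemireg.Wedge.HankelSiegelIdeal
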